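import Summits.MatrixMultiplication.MatrixMultiplication.Theorems.EdgePencilSixthConvexity
import Summits.MatrixMultiplication.MatrixMultiplication.Theorems.EdgePencilSixthConvexityWeb
import HarnessLib

/-!
# The two pieces of «rung-and-chord» are ABSORPTION (the rung) and DE-MULTIPLICATION (the chord);
# absolute certificates for either are all-or-nothing; degeneration-class rung certificates are
# block-dominated; a third lawful world

Support kernel for `stmt-MatrixMultiplication-26697` (`TetraExcessZero : ω(K₄) ≤ ω(2,1,2)`, the
attacked leaf of route `TetrahedronCarving`; lineage `decomp-mm-lens-6`, generation 25). Companion of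
`EdgePencilSixthMultiplicativity` (same generation: `χ(δ)` is the exponent of the unbalanced product
`T(K₄)_{⌈n^δ⌉} ⊠ D_{⌈n^{1−δ}⌉}`) and of `EdgePencilSixthConvexity` / `…Web` (g24). NOTATION as there:
`χ = omegaSix`, `ψ = ω(2,1,2) = χ(0)`, `T = ω(K₄) = χ(1)`, `D_n` the diamond, `SixRungPos : ∃ δ > 0,
χ(δ) ≤ ψ`, `MidTight : ψ + T ≤ 2χ(1/2)`, `FirstOrderFree : ∀ ε > 0 ∃ δ ∈ (0,1], χ(δ) ≤ ψ + εδ`,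
`RungLift : SixRungPos → leaf`. No item is added or changed.

* §3 The pieces re-read. `MidTight ⟺ χ is AFFINE on [0,1]` (`midTight_iff_affine`) ⟺ the exponent is
  ADDITIVE on the pair (tetrahedron, diamond), `2χ(1/2) = ψ + T` (`midTight_iff_pair_additive`): a
  DE-MULTIPLICATION statement (every algorithm for `T(K₄)_k ⊠ D_k` is as expensive as the two factors
  separately) — a RELATIVE LOWER bound. `SixRungPos ⟺ ∃ δ > 0: T(K₄)_{n^δ} ⊠ D_{n^{1−δ}}` costs no more
  (in exponent) than `D_{n^δ} ⊠ D_{n^{1−δ}} = D_n`: ABSORPTION — next to a polynomially larger diamond a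
  small tetrahedron costs no more than a small diamond (equivalently the diamond absorbs a pendant pair
  of size `n^δ` on its missing edge) — a RELATIVE UPPER bound on COST, which by §4 cannot come from a
  degeneration `D ⊠ A ⊵ W`; the leaf is the catalyst-free case `δ = 1`
  (`excessZero_iff_omegaSix_half_eq_omegaTetra`: `T(K₄)_k ⊠ D_k` costs as much as
  `T(K₄)_k ⊠ T(K₄)_k`). Under `MidTight` a rung anywhere IS the leaf
  (`sixRung_iff_excessZero_of_midTight`); the exact complement of the rung inside the leaf is
  `RungLift`, implied by `MidTight` (`rungLift_of_midTight`, `excessZero_iff_sixRungPos_and_rungLift`).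
* §4 **Absolute certificates are all-or-nothing** (over `ℂ`, by name). The record's only absolute
  lower bound on the ladder is `4` (flattening). An absolute lower bound `χ(δ) > 4` at ANY `δ` refutes
  the summit (`not_matrixMultiplication_of_four_lt_omegaSix`); an absolute rung certificate
  `χ(δ) ≤ 4` proves `HalfAlpha` (`α ≥ 1/2`) and pins `ψ = χ(δ) = 4` (`halfAlpha_of_omegaSix_le_four`);
  an absolute MidTight certificate `ψ + T ≤ 2L ≤ 2χ(1/2)` either has `L ≤ 4` and then proves
  `TetraFlat` with `T = ψ = 4`, or has `L > 4` and refutes `ω = 2` (`midTight_certificate_cases`);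
  exactly: `(∃ δ > 0, χ(δ) ≤ 4) ⟺ HalfAlpha ∧ SixRungPos` (`absRung_iff_halfAlpha_and_sixRungPos`) and
  `(∃ L ≤ 4, certificate) ⟺ TetraFlat` (`absMidTight_iff_tetraFlat`). So BOTH pieces can only be
  reached by RELATIVE arguments; and on the rung side the relative arguments of DEGENERATION type
  `D_{n^μ} ⊠ A ⊵ W_n^{(n^δ)}` with a catalyst at least as large as the target (`μ ≥ 1`) are dominated
  by the block cover (`rungCertificate_blockDominated`: the `{0,2}|{1,3}` flattening forces the
  auxiliary to cost `≥ n^{3+δ−3μ}`), and with a smaller catalyst they RECURSE to the rung at a smaller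
  scale with a larger relative pendant (`rungCertificate_recurses`); for the leaf itself a degeneration
  certificate can use (almost) no diamond catalyst at all (`leafCertificate_noCatalyst`:
  `(ψ−3)μ ≤ ψ−4`). What is left is ABSORPTION proper (strict sub-multiplicativity of
  cost on `D_n ⊠ EPR₀₁^{(n^δ)}`, the graph-tensor analogue of `α > 0`) on the rung side and a
  lower-bound TRANSFER (a common maximising spectral point) on the chord side — the planning content of
  this generation.
* §5 A third lawful world `quadratic` (`χ = ψ + (T−ψ)δ²`): `FirstOrderFree ∧ RungLift ∧ ¬SixRungPos ∧
  ¬MidTight ∧ ¬leaf`; with `hinge ⊨ ¬RungLift` and `affine ⊨ RungLift ∧ ¬leaf` (g24) this places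
  `RungLift` strictly below `MidTight`, independent of `SixRungPos` (`rungLift_undecided`), and shows
  `FirstOrderFree` strictly weaker than `SixRungPos` (announced in NODE-g24 §1d, now checked).

References: Strassen 1988 (asymptotic spectrum: additivity of the exponent on a pair ⟺ a common
maximising spectral point) [Strassen1988]; Christandl–Vrana–Zuiddam, arXiv:1609.07476, §1.1 (flattenings
of graph tensors), §1.3 [ChristandlVranaZuiddam2016]; Bürgisser–Clausen–Shokrollahi §15.5
[BurgisserClausenShokrollahi1997]; Lotti–Romani 1983 §2 [LottiRomani1983]; Le Gall 2012 §1 [LeGall2012].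
No `sorry`, no new axiom, no instance, no notation; one new `SixWorld` value (`quadratic`, §5) and no
other definition.
-/

noncomputable section

set_option linter.dupNamespace false

open Filter Asymptotics Finset Literature.Computability.AlgebraicComplexity
open Summit.MatrixMultiplication.MatrixMultiplication.Theorems.TetrahedronTensor
open Summit.MatrixMultiplication.MatrixMultiplication.Theorems.TetraDiagonal
open Summit.MatrixMultiplication.MatrixMultiplication.Theses.TetrahedronCarving

namespace Summit.MatrixMultiplication.MatrixMultiplication.Theorems.EdgePencil

/-! ## §3 The two pieces as de-multiplication (chord) and absorption (rung) -/

section Readings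

variable (F : Type) [Field F]

/-- **Sub-multiplicativity on the balanced pair**: `2χ(1/2) ≤ ψ + T`
(`R₄(T(K₄)_k ⊠ D_k) ≤ R₄(T(K₄)_k)·R₄(D_k)`; = midpoint convexity of `χ`).
[cite: BurgisserClausenShokrollahi1997, §15.5 (rank is sub-multiplicative under ⊠)] -/
theorem two_mul_omegaSix_half_le :
    2 * omegaSix F (1 / 2) ≤ omegaRect F 2 1 2 + omegaTetra F := by
  have h := omegaSix_le_chord F (by norm_num : (0 : ℝ) ≤ 1 / 2) (by norm_num : (1 / 2 : ℝ) ≤ 1)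
  linarith

/-- **MidTight ⟺ the exponent is ADDITIVE on the pair (tetrahedron, diamond)**: `2χ(1/2) = ψ + T`,
i.e. `T(K₄)_k ⊠ D_k` costs, in exponent, exactly as much as its two factors separately — a
de-multiplication statement (a relative LOWER bound). In Strassen's language: the tetrahedron and the
diamond share a maximising point of the asymptotic spectrum. [cite: Strassen1988, §1 (asymptotic spectrum)] -/
theorem midTight_iff_pair_additive :
    omegaRect F 2 1 2 + omegaTetra F ≤ 2 * omegaSix F (1 / 2) ↔
      2 * omegaSix F (1 / 2) = omegaRect F 2 1 2 + omegaTetra F :=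
  ⟨fun h => le_antisymm (two_mul_omegaSix_half_le F) h, fun h => h.ge⟩

/-- **The leaf ⟺ `χ(1/2) = T`**: `T(K₄)_k ⊠ D_k` costs, in exponent, as much as
`T(K₄)_k ⊠ T(K₄)_k = T(K₄)_{k²}` — replacing one tetrahedron factor by a diamond saves nothing
(K2 `growHalf_iff_tetraExcessZero`, valued form). [cite: LottiRomani1983, §2 (p. 174)] -/
theorem excessZero_iff_omegaSix_half_eq_omegaTetra :
    omegaTetra F ≤ omegaRect F 2 1 2 ↔ omegaSix F (1 / 2) = omegaTetra F := by
  rw [← omegaTetra_le_omegaSix_iff_excessZero F (by norm_num : (1 / 2 : ℝ) < 1)]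
  exact ⟨fun h => le_antisymm (omegaSix_le_omegaTetra F _) h, fun h => h.ge⟩

/-- **MidTight ⟺ the ladder is AFFINE**: `χ(δ) = (1−δ)ψ + δT` on `[0,1]` (`χ ≤ chord` always,
`χ ≥ chord` is `NoKink ⟺ MidTight`). Equivalently: the exponent is additive on EVERY unbalanced product
`T(K₄)_{n^δ} ⊠ D_{n^{1−δ}}`. [cite: LottiRomani1983, §2 (p. 174)] -/
theorem midTight_iff_affine :
    omegaRect F 2 1 2 + omegaTetra F ≤ 2 * omegaSix F (1 / 2) ↔
      ∀ δ : ℝ, 0 ≤ δ → δ ≤ 1 →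
        omegaSix F δ = (1 - δ) * omegaRect F 2 1 2 + δ * omegaTetra F := by
  rw [midTight_iff_noKink]
  exact ⟨fun h δ h0 h1 => le_antisymm (omegaSix_le_chord F h0 h1) (h δ h0 h1),
    fun h δ h0 h1 => (h δ h0 h1).ge⟩

/-- **Under MidTight a rung anywhere is the leaf**: for `δ ∈ (0,1]`, `χ(δ) ≤ ψ ⟺ T ≤ ψ`
(an affine non-decreasing function flat at one positive point is constant).
[cite: LottiRomani1983, §2 (p. 174)] -/
theorem sixRung_iff_excessZero_of_midTight
    (hmid : omegaRect F 2 1 2 + omegaTetra F ≤ 2 * omegaSix F (1 / 2)) {δ : ℝ} (h0 : 0 < δ) :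
    omegaSix F δ ≤ omegaRect F 2 1 2 ↔ omegaTetra F ≤ omegaRect F 2 1 2 :=
  ⟨fun hr => excessZero_of_sixRungPos_of_midTight F ⟨δ, h0, hr⟩ hmid,
    fun hE => sixRung_of_excessZero F hE δ⟩

/-- … so under `MidTight ∧ ¬leaf` the ladder is STRICTLY above `ψ` at every `δ > 0`
(no rung at all: the affine world of `EdgePencilSixthConvexityWeb`). -/
theorem omegaRect_lt_omegaSix_of_midTight_of_not_excessZero
    (hmid : omegaRect F 2 1 2 + omegaTetra F ≤ 2 * omegaSix F (1 / 2))
    (hne : ¬ omegaTetra F ≤ omegaRect F 2 1 2) {δ : ℝ} (h0 : 0 < δ) :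
    omegaRect F 2 1 2 < omegaSix F δ :=
  lt_of_not_ge fun hr => hne ((sixRung_iff_excessZero_of_midTight F hmid h0).1 hr)

/-- **MidTight ⟹ RungLift** (`RungLift : SixRungPos → leaf`, the exact complement of the rung inside the
leaf): the chord half of «rung-and-chord» is a SUFFICIENT form of the complement (K2's seam, curried).
[cite: LottiRomani1983, §2 (p. 174)] -/
theorem rungLift_of_midTight
    (hmid : omegaRect F 2 1 2 + omegaTetra F ≤ 2 * omegaSix F (1 / 2)) :
    (∃ δ : ℝ, 0 < δ ∧ omegaSix F δ ≤ omegaRect F 2 1 2) → omegaTetra F ≤ omegaRect F 2 1 2 :=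
  fun hr => excessZero_of_sixRungPos_of_midTight F hr hmid

/-- **leaf ⟺ SixRungPos ∧ RungLift** (modus ponens; the rung at `δ = 1` is the leaf). The weakest
two-piece anatomy of the leaf along the ladder; «rung-and-chord» replaces `RungLift` by the NAMED
sufficient condition `MidTight`. -/
theorem excessZero_iff_sixRungPos_and_rungLift :
    omegaTetra F ≤ omegaRect F 2 1 2 ↔
      (∃ δ : ℝ, 0 < δ ∧ omegaSix F δ ≤ omegaRect F 2 1 2) ∧
        ((∃ δ : ℝ, 0 < δ ∧ omegaSix F δ ≤ omegaRect F 2 1 2) → omegaTetra F ≤ omegaRect F 2 1 2) :=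
  ⟨fun hE => ⟨⟨1, zero_lt_one, by rw [omegaSix_one]; exact hE⟩, fun _ => hE⟩, fun h => h.2 h.1⟩

/-- NEC: `ω = 2 ⟹ RungLift` (indeed `ω = 2 ⟹` the leaf). -/
theorem rungLift_of_matrixMultiplication (hS : _root_.MatrixMultiplication) :
    (∃ δ : ℝ, 0 < δ ∧ omegaSix ℂ δ ≤ omegaRect ℂ 2 1 2) → TetraExcessZero :=
  fun _ => excessZero_of_matrixMultiplication hS

end Readings

/-! ## §4 Absolute certificates for either piece are all-or-nothing -/

section Certificates

/-- **Any absolute lower bound above `4` on any value of the ladder refutes the summit**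
(`ω = 2 ⟹ χ ≡ 4`). In particular a MidTight proof by an ABSOLUTE lower bound on `χ(1/2)` that is
informative (`> 4`) is a disproof of `ω = 2`. [cite: ChristandlVranaZuiddam2016, §1.3] -/
theorem not_matrixMultiplication_of_four_lt_omegaSix {δ : ℝ} (h : 4 < omegaSix ℂ δ) :
    ¬ _root_.MatrixMultiplication :=
  fun hS => (omegaSix_eq_four_of_matrixMultiplication hS δ).not_gt h

/-- **An absolute rung certificate proves `α ≥ 1/2`**: the record's only absolute lower bound on
`ψ = ω(2,1,2)` is `4`, so certifying a rung `χ(δ) ≤ ψ` by absolute values means `χ(δ) ≤ 4`, which gives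
`HalfAlpha` and pins `ψ = χ(δ) = 4` (at `δ = 1` it is `TetraFlat`). Hence `SixRungPos` can only be
reached RELATIVELY (a reduction `D`-algorithms ⇝ `W^{(n^δ)}`-algorithms). [cite: LeGall2012, §1] -/
theorem halfAlpha_of_omegaSix_le_four {δ : ℝ} (h : omegaSix ℂ δ ≤ 4) :
    HalfAlpha ∧ omegaRect ℂ 2 1 2 = 4 ∧ omegaSix ℂ δ = 4 := by
  have hψ : omegaRect ℂ 2 1 2 ≤ 4 := (omegaRect_two_one_two_le_omegaSix ℂ δ).trans h
  exact ⟨(omegaRect_two_one_two_le_four_iff_half_le_dualExponentAlpha ℂ).1 hψ,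
    le_antisymm hψ (four_le_omegaRect_two_one_two ℂ), le_antisymm h (four_le_omegaSix ℂ δ)⟩

/-- An absolute MidTight certificate (`L ≤ χ(1/2)` with `ψ + T ≤ 2L`) does certify MidTight … -/
theorem midTight_of_certificate {L : ℝ} (hL : L ≤ omegaSix ℂ (1 / 2))
    (hcert : omegaRect ℂ 2 1 2 + omegaTetra ℂ ≤ 2 * L) :
    omegaRect ℂ 2 1 2 + omegaTetra ℂ ≤ 2 * omegaSix ℂ (1 / 2) :=
  hcert.trans (by linarith)

/-- **… but it is all-or-nothing**: either `L ≤ 4`, and then it proves `TetraFlat` with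
`T = ψ = χ(1/2) = 4` (the whole ladder collapses to the flattening value), or `L > 4`, and then it
REFUTES `ω = 2`. So an informative proof of `MidTight` short of `TetraFlat` is necessarily RELATIVE
(a lower-bound transfer between the two factors of `T(K₄)_k ⊠ D_k`), never an evaluation.
[cite: ChristandlVranaZuiddam2016, §1.3] -/
theorem midTight_certificate_cases {L : ℝ} (hL : L ≤ omegaSix ℂ (1 / 2))
    (hcert : omegaRect ℂ 2 1 2 + omegaTetra ℂ ≤ 2 * L) :
    (L ≤ 4 ∧ TetraFlat ∧ omegaTetra ℂ = 4 ∧ omegaRect ℂ 2 1 2 = 4 ∧ omegaSix ℂ (1 / 2) = 4) ∨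
      (4 < L ∧ ¬ _root_.MatrixMultiplication) := by
  rcases le_or_gt L 4 with h4 | h4
  · left
    have hψ4 : 4 ≤ omegaRect ℂ 2 1 2 := four_le_omegaRect_two_one_two ℂ
    have hψT : omegaRect ℂ 2 1 2 ≤ omegaTetra ℂ := omegaRect_two_one_two_le_omegaTetra ℂ
    have hχT : omegaSix ℂ (1 / 2) ≤ omegaTetra ℂ := omegaSix_le_omegaTetra ℂ _
    have hχ4 : 4 ≤ omegaSix ℂ (1 / 2) := four_le_omegaSix ℂ _
    have hT4 : omegaTetra ℂ ≤ 4 := by linarith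
    exact ⟨h4, hT4, le_antisymm hT4 (hψ4.trans hψT), le_antisymm (hψT.trans hT4) hψ4,
      le_antisymm (hχT.trans hT4) hχ4⟩
  · exact Or.inr ⟨h4, not_matrixMultiplication_of_four_lt_omegaSix (h4.trans_le hL)⟩

/-- **Absolute rung ⟺ rung ∧ HalfAlpha**: `(∃ δ > 0, χ(δ) ≤ 4) ⟺ (α ≥ 1/2) ∧ SixRungPos`. The only
absolute form of the rung is the rung together with the famous open rectangular statement.
[cite: LeGall2012, §1] -/
theorem absRung_iff_halfAlpha_and_sixRungPos :
    (∃ δ : ℝ, 0 < δ ∧ omegaSix ℂ δ ≤ 4) ↔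
      HalfAlpha ∧ ∃ δ : ℝ, 0 < δ ∧ omegaSix ℂ δ ≤ omegaRect ℂ 2 1 2 := by
  constructor
  · rintro ⟨δ, hδ, h⟩
    obtain ⟨hα, hψ, -⟩ := halfAlpha_of_omegaSix_le_four h
    exact ⟨hα, δ, hδ, h.trans hψ.ge⟩
  · rintro ⟨hα, δ, hδ, h⟩
    exact ⟨δ, hδ,
      h.trans ((omegaRect_two_one_two_le_four_iff_half_le_dualExponentAlpha ℂ).2 hα)⟩

/-- **An absolute MidTight certificate that does not refute the summit is exactly `TetraFlat`**:
`(∃ L ≤ 4, L ≤ χ(1/2) ∧ ψ + T ≤ 2L) ⟺ ω(K₄) ≤ 4`. [cite: ChristandlVranaZuiddam2016, §1.3] -/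
theorem absMidTight_iff_tetraFlat :
    (∃ L : ℝ, L ≤ 4 ∧ L ≤ omegaSix ℂ (1 / 2) ∧ omegaRect ℂ 2 1 2 + omegaTetra ℂ ≤ 2 * L) ↔
      TetraFlat := by
  constructor
  · rintro ⟨L, hL4, hL, hcert⟩
    rcases midTight_certificate_cases hL hcert with ⟨-, hflat, -⟩ | ⟨h4, -⟩
    · exact hflat
    · exact absurd hL4 (not_le.2 h4)
  · intro hflat
    have hT4 : omegaTetra ℂ ≤ 4 := hflat
    refine ⟨4, le_rfl, four_le_omegaSix ℂ _, ?_⟩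
    linarith [omegaRect_two_one_two_le_omegaTetra ℂ]

/-- **BARRIER NOTE (rung side, degeneration class) — the exponent bookkeeping.** A relative rung
certificate of the shape `D_{n^μ} ⊠ A ⊵ W_n^{(n^δ)}` (restriction or degeneration from a diamond of size
`n^μ` times an auxiliary 4-tensor `A` with `R(A) ≤ n^{a+o(1)}`) yields `χ(δ) ≤ ψμ + a`. The flattening
across the cut `{0,2} | {1,3}` is a degeneration monotone, multiplicative under `⊠`, at most the rank,
and equals the product of the crossing bonds on a graph tensor: `m³` on `D_m` (edges `03, 12, 23`) and
`m³e` on `W_m^{(e)}` (edge `01` crosses as well); hence `3μ + a ≥ 3 + δ`. For a catalyst at least as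
large as the target (`μ ≥ 1`, in particular for `D_{n^δ} ⊠ D_{n^{1−δ}} = D_n` itself, where no `A` with
`a < δ` can exist at all) the certificate is DOMINATED BY THE BLOCK COVER `χ(δ) ≤ ψ + δ`
(`EdgePencilSixthLadder.omegaSix_le_add`), so it is never a rung: absorption is not a degeneration.
(Smaller catalysts, `μ < 1`, need an auxiliary carrying `≥ n^{4(1−μ)}` across `{0,1} | {2,3}` — a
diamond-substitute.) Only the arithmetic is checked here; the flattening dictionary is the memo's
(NODE-g25 §3). [cite: ChristandlVranaZuiddam2016, §1.1 (flattenings of graph tensors)] -/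
theorem rungCertificate_blockDominated {ψ δ μ a : ℝ} (hψ : 3 ≤ ψ) (hμ : 1 ≤ μ)
    (hflat : 3 + δ ≤ 3 * μ + a) : ψ + δ ≤ ψ * μ + a := by
  nlinarith [mul_nonneg (sub_nonneg.2 hψ) (sub_nonneg.2 hμ)]

/-- **… and below the target the certificate RECURSES (`μ ≤ 1` branch).** If a degeneration certificate
`D_{n^μ} ⊠ A ⊵ W_n^{(n^δ)}` is to be a rung (`ψμ + a ≤ ψ`), the `{0,2}|{1,3}` constraint
`3μ + a ≥ 3 + δ` forces the catalyst to be polynomially SMALLER than the target, `δ ≤ (ψ−3)(1−μ)`, and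
the `{0,1}|{2,3}` constraint `4μ + a ≥ 4` (values `m⁴` on `D_m` and on `W_m^{(e)}`) makes the auxiliary
carry `a ≥ 4(1−μ)`: `A` has the flattening profile of `W_{n^κ}^{(n^δ)}`, `κ = 1 − μ ≥ δ/(ψ−3)`, at the
price `ψκ` of `D_{n^κ}` — the rung AGAIN, at a smaller scale and a LARGER relative pendant
`δ/κ ∈ [δ, ψ−3]` (`ψ − 3 > 1`: up to the top of the ladder). Degeneration certificates never reduce
the rung; between `κ = 1` (circular) and `κ = δ/(ψ−3)` (leaf-scale) they interpolate. Arithmetic only;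
dictionary in NODE-g25 §3. [cite: ChristandlVranaZuiddam2016, §1.1 (flattenings of graph tensors)] -/
theorem rungCertificate_recurses {ψ δ μ a : ℝ} (hrung : ψ * μ + a ≤ ψ)
    (hflat : 3 + δ ≤ 3 * μ + a) (hflat' : 4 ≤ 4 * μ + a) :
    δ ≤ (ψ - 3) * (1 - μ) ∧ 4 * (1 - μ) ≤ a := by
  constructor <;> nlinarith

/-- **The same bookkeeping for the LEAF itself**: a degeneration certificate `D_{n^μ} ⊠ A ⊵ T(K₄)_n`
of cost `ψμ + a ≤ ψ` (which would prove `TetraExcessZero`) has `3μ + a ≥ 4` from the `{0,2}|{1,3}`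
flattening (`m³` on `D_m`, `m⁴` on `T(K₄)_m`: edges `01, 03, 12, 23` cross), hence
`(ψ−3)μ ≤ ψ − 4`: the diamond catalyst carries at most the fraction `(ψ−4)/(ψ−3)` of the scale
(`= 0` if `ψ = 4`, `< 0.08` on the record `ψ ≤ 4.0884`) and the auxiliary alone costs `a ≥ 4 − 3μ`,
i.e. is an absolute construction for (almost all of) the tetrahedron at the diamond's price. Relative
certification of the leaf BY DEGENERATION is therefore all-or-nothing as well. Arithmetic only.
[cite: ChristandlVranaZuiddam2016, §1.1] -/
theorem leafCertificate_noCatalyst {ψ μ a : ℝ} (hleaf : ψ * μ + a ≤ ψ) (hflat : 4 ≤ 3 * μ + a) :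
    (ψ - 3) * μ ≤ ψ - 4 ∧ 4 - 3 * μ ≤ a := by
  constructor <;> nlinarith

end Certificates

/-! ## §5 A third lawful world: `RungLift` and `FirstOrderFree` are strictly weak -/

namespace SixWorld

/-- **The quadratic world** (`ω = 2.37`, `ψ = 4.08`, `T = 4.3`, `χ(δ) = ψ + (T−ψ)δ² = 4.08 + 0.22δ²`):
all recorded laws hold (block: `0.22δ² ≤ δ`; top: `0.78 − δ + 0.22δ² = (1−δ)(0.78−0.22δ) ≥ 0`;
symmetrisation: `2.98 − 4.3δ + 1.32δ² = (1−δ)(2.98−1.32δ) ≥ 0`, tight at `δ = 1`). Here the ladder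
leaves `ψ` to SECOND order: `FirstOrderFree` holds, `SixRungPos` fails, `MidTight` fails (strict
convexity), the leaf fails, and `RungLift` holds vacuously. -/
noncomputable def quadratic : SixWorld where
  om := 2.37
  psi := 4.08
  tet := 4.3
  chi := fun δ => 4.08 + 0.22 * δ ^ 2
  chi_zero := by norm_num
  chi_one := by norm_num
  two_le_om := by norm_num
  four_le_psi := by norm_num
  psi_le_cover := by norm_num
  tet_le_two_mul := by norm_num
  kappa := by norm_num
  mono := fun δ δ' h0 h _ => by
    nlinarith [mul_nonneg h0 (sub_nonneg.2 h), sq_nonneg (δ' - δ)]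
  convex := by
    refine ⟨convex_Icc 0 1, fun x _ y _ a b ha hb hab => ?_⟩
    simp only [smul_eq_mul]
    obtain rfl : b = 1 - a := by linarith
    nlinarith [mul_nonneg (mul_nonneg ha hb) (sq_nonneg (x - y))]
  block := fun δ h0 h1 => by
    nlinarith [mul_nonneg h0 (sub_nonneg.2 h1)]
  top := fun δ h0 h1 => by
    nlinarith [mul_nonneg (sub_nonneg.2 h1) (show (0 : ℝ) ≤ 0.78 - 0.22 * δ by linarith)]
  symm := fun δ h0 h1 => by
    nlinarith [mul_nonneg (sub_nonneg.2 h1) (show (0 : ℝ) ≤ 2.98 - 1.32 * δ by linarith)]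

/-- **`RungLift` is not decided by the record, is strictly weaker than `MidTight`, and is independent
of `SixRungPos`; `FirstOrderFree` is strictly weaker than `SixRungPos`.** In the quadratic world:
`RungLift` (vacuously), `¬SixRungPos`, `FirstOrderFree`, `¬MidTight`, `¬leaf`; in the hinge world
(`SixRungPos ∧ ¬leaf`): `¬RungLift`. (In the affine world: `RungLift ∧ MidTight ∧ ¬leaf`, K2-Web.) -/
theorem rungLift_undecided :
    ((((∃ δ : ℝ, 0 < δ ∧ quadratic.chi δ ≤ quadratic.psi) → quadratic.tet ≤ quadratic.psi) ∧
        (¬ ∃ δ : ℝ, 0 < δ ∧ quadratic.chi δ ≤ quadratic.psi) ∧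
        (∀ ε : ℝ, 0 < ε → ∃ δ : ℝ, 0 < δ ∧ δ ≤ 1 ∧ quadratic.chi δ ≤ quadratic.psi + ε * δ) ∧
        ¬ (quadratic.psi + quadratic.tet ≤ 2 * quadratic.chi (1 / 2)) ∧
        ¬ quadratic.tet ≤ quadratic.psi)) ∧
      ¬ ((∃ δ : ℝ, 0 < δ ∧ hinge.chi δ ≤ hinge.psi) → hinge.tet ≤ hinge.psi) := by
  have hno : ¬ ∃ δ : ℝ, 0 < δ ∧ quadratic.chi δ ≤ quadratic.psi := by
    rintro ⟨δ, hδ, h⟩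
    simp only [quadratic] at h
    have := pow_pos hδ 2
    linarith
  refine ⟨⟨fun h => absurd h hno, hno, fun ε hε => ?_, by norm_num [quadratic],
    by norm_num [quadratic]⟩, fun h => ?_⟩
  · refine ⟨min 1 ε, lt_min one_pos hε, min_le_left _ _, ?_⟩
    simp only [quadratic]
    have hm0 : 0 < min 1 ε := lt_min one_pos hε
    have hmε : min 1 ε ≤ ε := min_le_right _ _
    nlinarith [mul_le_mul_of_nonneg_left hmε hm0.le, sq_nonneg (min 1 ε)]
  · have h' := h ⟨1 / 2, by norm_num, by norm_num [hinge]⟩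
    norm_num [hinge] at h'

end SixWorld

end Summit.MatrixMultiplication.MatrixMultiplication.Theorems.EdgePencil

end
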